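import Summits.QuantumAdvantage.QuantumAdvantage.Theorems.ResponseDialJ

/-!
# BlindDial part A (§0–§2: datum, same-parity pair moves, rotations) — Theorems twin (tree landing, census lane decomp-qadv)
of NODE «BlindDial» (decomp-qadv-lens-2, gen 20)

Verbatim content of §0–§2 of the lens node file
`run/shared/lean/pub/decomp-qadv/decomp-qadv-lens-2/g20/BlindDial.lean` (sha256 b5816ebc…, 919 l; farm rc 0 · 0 err · 0 warn ·
0 sorry; axioms std) under the `Theorems.BlindDial` namespace (the node elaborates under `Theses.BlindDial`); every declaration
documented; linear import chain `ResponseDialJ → BlindDialA → BlindDialB → BlindDialC`.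
Supports stmt-QuantumAdvantage-27656 (`Theses.SparsityDial.DenseGenericLoss3` = D, DRAFT route-QuantumAdvantage-SparsityDial).
The node's module docstring follows verbatim (the pieces `BlindLoss3` / `SightedGenericLoss3` / `closes` and the decided rung
`paleyCounterLoss3 : Theorems.ResponseDial.PaleyCounterLoss3` are in part C).

# NODE «BlindDial» (decomp-qadv-lens-2, gen 20; lens «structural dichotomy (special vs generic)»; RESIDUAL MODE on
`Theses.SparsityDial.DenseGenericLoss3` = D, stmt-QuantumAdvantage-27656 of DRAFT route-QuantumAdvantage-SparsityDial)

**Target (verbatim, by name):** `Summit.QuantumAdvantage.QuantumAdvantage.Theses.SparsityDial.DenseGenericLoss3`.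
**Node:** `D ⟸ BlindLoss3 ∧ SightedGenericLoss3` (`closes`, BY NAME), with `BlindLoss3` PROVED here (`blindLoss3`), hence
`sighted_iff_dense : SightedGenericLoss3 ↔ D` — an honest **LAW node** (one law decided + the re-typed residual), exactly as
the critic's LAW/LADDER doctrine (rows 69v49/69v50) classifies such cuts; no child route is requested.

**★ What the law DECIDES (0 sorry, std axioms):** `paleyCounterLoss3 : Theorems.ResponseDial.PaleyCounterLoss3` — the
residual's FIRST UNDECIDED NAMED INSTANCE as recorded by TREE N94 / critic 69v50 / ResponseDial §14 ("response-rich; outside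
the orbit-certificate method by the TYPE-SPAN criterion; the engine that would decide it is a character-sum law") — is a
THEOREM, with NO character sum: `windowCounterLoss3_of_odd` proves `WindowCounterLoss3 W` (constants `C = 1`, `n₀ = 4096`)
for EVERY window system `W` over ODD cells (Paley, intervals — `multiCounterLoss3'` re-proves the §12 rung with no
certificate —, random, adversarial), and more generally `blind_loss` for every BLIND field (below).

## The dial phrase (new in the lineage V1–V21): BLINDNESS TO A SAME-PARITY PAIR MOVE
All previous engines of this lineage move the input along ADJACENT pair flips `{b, b+1}` (one odd, one even cell), to which
an odd-cell counter RESPONDS; ResponseDial §13–§14 proved that response-rich families (Paley) defeat every orbit certificate.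
Here the move is the SAME-PARITY pair flip `τ_e : x ↦ x ⊕ 1_e ⊕ 1_{e+2}` at the EVEN cell `e = ⌊N/2⌋ + 6 + (⌊N/2⌋ mod 2)`:
it preserves `OddZeros`, it is INVISIBLE to every reader of odd cells, and — with the middle cell pinned, `x_{e+1} = 0` —
it moves exactly ONE kernel phase: `c_{e+1} ↦ c_{e+1} ± 1`, all other `c_k (mod 3)` fixed (`cN_pmv_mid_false`; the two
opposite kinks cancel).  A field `P` is **BLIND** (`Blind P`, §3; NO degree / sparsity / window / equivariance hypothesis)
when its deviation-from-the-canonical-guess indicator splits as `[k ∈ dev P x] = B_k(x) ⊕ ptr_k(x)` with every `B_k`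
independent of the ten even MOVED cells `{0,2,4,6,10,12,14,16,e,e+2}` and `ptr` = the two antipodal POINTER READERS
`k₀ = e − ⌊N/2⌋ ∈ {6,7}… (even: k₀ = 6 + (⌊N/2⌋ mod 2))`, `k₀ + 2` reading `x_e`, `x_{e+2}`.  Every `wStrat W` with odd
windows is blind (`wStrat_blind`): its first half-cycle is the antipodal pointer, its second half reads odd cells only.

## The engine (§4; scale `N ≥ 64`; parity bookkeeping + ONE finite core by `decide`; no `native_decide`)
* INVOLUTION (`win_flip`): for blind `P`, odd `x` with `x_{e+1} = 0`, the good-deviation count `#F(x)` (`win_iff`) changes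
  under `τ_e` at three positions only — the readers `k₀, k₀+2` TOGGLE their deviation (kernel bits `g` fixed), position
  `e+1` keeps its deviation bit `d` and moves its kernel bit `g_{e+1} → g'_{e+1}` — so the win bit flips iff
  `Δ_e(x) := g_{k₀} ⊕ g_{k₀+2} ⊕ (d ∧ (g_{e+1} ≠ g'_{e+1})) = 1` (`delta`), and `Δ_e ∘ τ_e = Δ_e` (`delta_tau`).  Hence on
  `Q = {odd, x_{e+1} = 0, Δ_e = 1}` the move is a win-flipping involution: `#Q ≤ 2·#{odd losers}` (`QQ_le`, via
  `AnchorDial.card_filter_orbL`).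
* REACHABILITY (`reach`, `AA_le`): the 16 ROTATIONS `ρ_ε` = optional same-parity pair flips at `{0,2}, {4,6}, {10,12},
  {14,16}` with the sign cells `1, 5, 11, 15` and the cell `k₀+1` pinned to `1` preserve blindness data (`dev_rot`) and
  shift the phases by `T + 2M` at `k₀, k₀+2` and by `T + M` at `e+1` (`cN_rot_low/high`), `T, M ∈ {0, ±1, ±1 ± 1}` signed by
  the parities at the sign cells; the profile of `Δ_e` along the 16 rotations is an explicit Boolean function `coreD` of
  `(c_{k₀}, c_{e+1} mod 3, three parities, d, four sign parities)` and `core` (2¹¹ × 16 cases, `decide`) finds a rotation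
  with `Δ_e = 1`; so `#A ≤ 16·#Q` on the pinned class `A`, and a 7-cell fixup gives `2^N ≤ 2⁷·#A` (`univ_le_AA`,
  ResponseDial's `fibre_le_pow`).  Total `#odd ≤ 4096·#{odd losers}` (`blind_loss_count`) ⇒ `blind_loss` via the landed
  `SparsityDial.real_loss_of_frac`; `blind_gauge_loss`: the law is gauge-universal (`StabilizerDial.rel_pad_iff`).

## Pieces (NODE OUTPUT CONTRACT; probes in `bc/Probe.lean`)
* A · `BlindLoss3` · **PROVED** (`blindLoss3`) · WEAKER than D (probe `BlindLoss3 → D` must-fail; A is a theorem, D open) ·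
  degree-free, so it is not an instance of D's hypothesis list but a LAW about a structured class that D's class meets
  (every odd-window `wStrat`, `wStrat_in_dense_class`).
* B · `SightedGenericLoss3` := D restricted to `¬ Blind P` · **RESIDUAL ≡ D** given A (`sighted_iff_dense`; COSTUME as a
  stand-alone piece — declared, not hidden) · carries ALL the difficulty · its re-based FIRST UNDECIDED NAMED INSTANCE is
  `FullPaleyCounterLoss3 := WindowCounterLoss3 fullPaleyW` (§7: Paley windows over BOTH parities; `D ⟹` it by name,
  `fullPaleyCounterLoss3_of_dense`), which is SIGHTED (every even moved cell lies in ≈ half the windows, so a reader other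
  than the two pointers sees the pair) and response-rich (§14's TYPE-SPAN obstruction stands) — UNDECIDED(test: census
  brute force / sampling of the win fraction of `wStrat (fullPaleyW n)` at `n = 16…28`; the scratch sampler of this seat
  gives loss fractions ≈ 0.5 for the odd-Paley family at `n ≤ 100`, consistent with the theorem, and was not run on the
  full family at scale — kit not allowed in this seat) · IDEA-NEEDED: a move family blind for QR-windows (flip a whole
  pattern class `{i : χ(i+k) constant on the readers that matter}`?) or a second-moment law.

## Why this is novel (one sentence)
The TYPE-SPAN ceiling of ResponseDial §13 ("no orbit certificate for response-rich windows") is MOVE-FAMILY-RELATIVE: changing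
the move from adjacent pairs to same-parity pairs makes every odd-cell counter response-FREE, and then no certificate,
character sum or equidistribution is needed — a parity identity plus a 2¹¹-case kernel computation decides the Paley rung
and every odd-window family at once; nothing in V1–V20 (sparsity, anchors, holonomy, locus, stabilizer, additivity of
response) moves the input invisibly to the field.

## Why each piece is strictly weaker / honest scope
A is PROVED (hence weaker than the open D in the only sense available) and does not mention degree; B is D minus a
theorem — EQUIVALENT to D, smaller in extension (the blind world, incl. every pointer/odd-counter witness family the lineage
has named so far: antipodal, half-counter, multi-counter, Paley, is removed by a theorem).  Barrier placement: the law is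
outside the degree-`(log n)^c` / Smolensky regime altogether (no degree enters); it does not touch the generic sighted
low-degree field, where D's difficulty (Bhowmick–Lovett-type equidistribution of high-arity low-degree indexing) remains.

## Dropped cuts (this generation; see NODE-g20.md): complementary Π/¬Π cuts with a provable structured side (≡ LAW nodes —
accepted, this is one); unsaturated sighted side as a genuine piece (padding `pad P s` preserves wins ⇒ ≡ D); saturated
`¬StabΣ` sides (need a gauge-universal certificate); gauge-invariant structural properties of `P` at `x` (only the win bit
survives); input-class dichotomies (costume); majority amplification (≡ T); proving `¬ Blind (wStrat fullPaleyW)` in Lean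
(needs a QR in a length-`N/2` interval — Pólya–Vinogradov, not in the tree; left informal).
-/


set_option linter.dupNamespace false
noncomputable section
open scoped Classical

namespace Summit.QuantumAdvantage.QuantumAdvantage.Theorems.BlindDial
open Finset
open Literature.Computability.QuantumComplexity Literature.Computability.QuantumComplexity.RingHLF
open Literature.Computability.MetaComplexity Literature.Computability.MetaComplexity.Smolensky
open Summit.QuantumAdvantage.AdviceFreeQNC0
open Summit.QuantumAdvantage.QuantumAdvantage.Theorems.AnchorDial (outB dev cN fz fz_apply orbL orbL_cons orbL_nil
  oddZeros_orbL zpar_orbL orbL_apply_of_far cN_orbL orbL_invol card_filter_orbL sh sgN cN_succ win_iff gCond_iff_cN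
  flip2 zpar_flip2 loss_shape_mono)
open Summit.QuantumAdvantage.QuantumAdvantage.Theorems.HolonomyDial (gCond tPoly tPoly_apply xorP xorP_apply_bool indP
  indP_apply mono_singleton_apply)
open Summit.QuantumAdvantage.QuantumAdvantage.Theorems.StabilizerDial (apIdx apStrat bitP bitP_apStrat pad rel_pad_iff
  StabFew)
open Summit.QuantumAdvantage.QuantumAdvantage.Theorems.SparsityDial (real_loss_of_frac)
open Summit.QuantumAdvantage.QuantumAdvantage.Theorems.ResponseDial (loddG wStrat wStrat_agree wStrat_mem paleyW
  WindowCounterLoss3 PaleyCounterLoss3 windowCounterLoss3_of_dense wStrat_in_dense_class tog0 oddZeros_tog0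
  fibre_le_pow mem_dev_apStrat mcStrat MultiCounterLoss3 mcStrat_eq_wStrat)
open Summit.QuantumAdvantage.QuantumAdvantage.Theses.SparsityDial (DenseGenericLoss3)

variable {N : ℕ}

/-! ## §0 The datum: watched pair, pointer readers, rotation cells -/

/-- the watched EVEN cell `e = ⌊N/2⌋ + 6 + (⌊N/2⌋ mod 2)` of the second half-cycle. -/
def eW (N : ℕ) : ℕ := N / 2 + 6 + N / 2 % 2

/-- its first POINTER READER `k₀ = e − ⌊N/2⌋ ∈ {6, 7}`: position `k₀` plays `t_{k₀} ⊕ x_e`, position `k₀ + 2` plays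
`t_{k₀+2} ⊕ x_{e+2}` (antipodal pointer). -/
def kW (N : ℕ) : ℕ := 6 + N / 2 % 2

/-- BlindDialA helper `eW_eq` (decomp-qadv g20 land package; see the module docstring). -/
theorem eW_eq (N : ℕ) : eW N = kW N + N / 2 := by unfold eW kW; omega

/-- BlindDialA helper `eW_mod_two` (decomp-qadv g20 land package; see the module docstring). -/
theorem eW_mod_two (N : ℕ) : eW N % 2 = 0 := by unfold eW; omega

/-- BlindDialA helper `kW_bound` (decomp-qadv g20 land package; see the module docstring). -/
theorem kW_bound (N : ℕ) : 6 ≤ kW N ∧ kW N ≤ 7 := by unfold kW; omega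

/-- the ten MOVED cells: the rotation pairs `{0,2}, {4,6}, {10,12}, {14,16}` and the watched pair `{e, e+2}` — all EVEN. -/
def Moved (N j : ℕ) : Prop :=
  j = 0 ∨ j = 2 ∨ j = 4 ∨ j = 6 ∨ j = 10 ∨ j = 12 ∨ j = 14 ∨ j = 16 ∨ j = eW N ∨ j = eW N + 2

/-- BlindDialA helper `moved_even` (decomp-qadv g20 land package; see the module docstring). -/
theorem moved_even {N j : ℕ} (h : Moved N j) : j % 2 = 0 := by
  have := eW_mod_two N; unfold Moved at h; omega

/-- BlindDialA helper `not_moved_of_odd` (decomp-qadv g20 land package; see the module docstring). -/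
theorem not_moved_of_odd {N j : ℕ} (h : j % 2 = 1) : ¬ Moved N j := fun hm => by
  have := moved_even hm; omega

/-! ## §1 The moves: a same-parity pair flip is two adjacent pair-flips -/

/-- the optional SAME-PARITY PAIR MOVE at `a`: flip cells `a` and `a + 2` — the adjacent pair-flips at `a` and `a + 1`
composed (cell `a + 1` is flipped twice), so the tree's orbit calculus (`orbL`, `cN_orbL`) applies verbatim. -/
def pmv (t : Bool) (a : ℕ) (x : Fin N → Bool) : Fin N → Bool := fz t a (fz t (a + 1) x)

/-- BlindDialA helper `pmv_eq_orbL` (decomp-qadv g20 land package; see the module docstring). -/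
theorem pmv_eq_orbL (t : Bool) (a : ℕ) (x : Fin N → Bool) : pmv t a x = orbL [(t, a), (t, a + 1)] x := rfl

/-- BlindDialA helper `pmv_apply` (decomp-qadv g20 land package; see the module docstring). -/
theorem pmv_apply (t : Bool) (a : ℕ) (x : Fin N → Bool) (j : Fin N) :
    pmv t a x j = if t = true ∧ (j.val = a ∨ j.val = a + 2) then !x j else x j := by
  unfold pmv
  rw [fz_apply, fz_apply]
  cases t
  · simp
  · simp only [true_and]
    by_cases hA : j.val = a ∨ j.val = a + 2
    · rw [if_pos hA]
      rcases hA with h | h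
      · rw [if_pos (Or.inl h), if_neg (by omega)]
      · rw [if_neg (by omega), if_pos (Or.inr (by omega))]
    · rw [if_neg hA]
      by_cases hB : j.val = a + 1
      · rw [if_pos (Or.inr hB), if_pos (Or.inl hB), Bool.not_not]
      · rw [if_neg (by omega), if_neg (by omega)]

/-- BlindDialA helper `pmv_apply_of_ne` (decomp-qadv g20 land package; see the module docstring). -/
theorem pmv_apply_of_ne (t : Bool) {a : ℕ} (x : Fin N → Bool) {j : Fin N} (h1 : j.val ≠ a) (h2 : j.val ≠ a + 2) :
    pmv t a x j = x j := by
  rw [pmv_apply, if_neg (fun h => by rcases h with ⟨-, h | h⟩ <;> omega)]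

/-- BlindDialA helper `oddZeros_pmv` (decomp-qadv g20 land package; see the module docstring). -/
theorem oddZeros_pmv (t : Bool) {a : ℕ} (ha : a + 3 ≤ N) (x : Fin N → Bool) : OddZeros (pmv t a x) ↔ OddZeros x := by
  rw [pmv_eq_orbL]
  exact oddZeros_orbL _ (fun p hp => by
    simp only [List.mem_cons, List.not_mem_nil, or_false] at hp
    rcases hp with rfl | rfl <;> dsimp only <;> omega) x

/-- prefix parities under the pair move: unchanged off the two parity sites `a + 1`, `a + 2`. -/
theorem zpar_pmv_of_ne (t : Bool) {a : ℕ} (ha : a + 3 ≤ N) (x : Fin N → Bool) (k : ℕ) (hk : k ≤ N)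
    (h1 : k ≠ a + 1) (h2 : k ≠ a + 2) : zpar (pmv t a x) k = zpar x k := by
  rw [pmv_eq_orbL]
  exact zpar_orbL _ (fun p hp => by
    simp only [List.mem_cons, List.not_mem_nil, or_false] at hp
    rcases hp with rfl | rfl <;> dsimp only <;> omega) x k hk (fun p hp => by
    simp only [List.mem_cons, List.not_mem_nil, or_false] at hp
    rcases hp with rfl | rfl <;> dsimp only <;> omega)

/-- … and COMPLEMENTED at the parity site `a + 1`. -/
theorem zpar_pmv_succ {a : ℕ} (ha : a + 3 ≤ N) (x : Fin N → Bool) : zpar (pmv true a x) (a + 1) = !zpar x (a + 1) := by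
  show zpar (flip2 a (a + 1) (flip2 (a + 1) (a + 1 + 1) x)) (a + 1) = _
  rw [zpar_flip2 (show a < a + 1 by omega) _ (a + 1) (by omega), if_pos ⟨by omega, le_rfl⟩,
    zpar_flip2 (show a + 1 < a + 1 + 1 by omega) _ (a + 1) (by omega), if_neg (by omega)]

/-- kernel phases under the pair move at `a` when the middle cell holds `0`: ONLY position `a + 1` moves, by the
sign `sgN (zpar x (a+1)) ∈ {1, 2}`; the total `W` and every other prefix weight are unchanged `mod 3`. -/
theorem cN_pmv_mid_false {a : ℕ} (ha : a + 4 ≤ N) (x : Fin N → Bool) (hx : x ⟨a + 1, by omega⟩ = false)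
    (k : ℕ) (hk : k ≤ N) :
    cN (pmv true a x) k % 3 = (cN x k + if k = a + 1 then sgN (zpar x (a + 1)) else 0) % 3 := by
  rw [pmv_eq_orbL, cN_orbL x k hk _ (fun p hp => by
    simp only [List.mem_cons, List.not_mem_nil, or_false] at hp
    rcases hp with rfl | rfl <;> dsimp only <;> omega) (by simp)]
  have hz : zpar x (a + 1 + 1) = !zpar x (a + 1) := by
    rw [zpar_succ x (show a + 1 < N by omega), hx]; simp
  simp only [List.map_cons, List.map_nil, List.sum_cons, List.sum_nil]
  rw [hz]
  cases zpar x (a + 1) <;> by_cases h1 : a + 1 ≤ k <;> by_cases h2 : a + 1 + 1 ≤ k <;> by_cases h3 : k = a + 1 <;>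
    simp [sh, sgN, h1, h2, h3] <;> omega

/-- kernel phases under the pair move at `a` when the middle cell holds `1`: every position `≥ a + 2` moves by
`s`, every position `≤ a` by `2s` (`s = sgN (zpar x (a+1))`) — a ROTATION of the later phases relative to the earlier. -/
theorem cN_pmv_mid_true {a : ℕ} (ha : a + 4 ≤ N) (x : Fin N → Bool) (hx : x ⟨a + 1, by omega⟩ = true)
    (k : ℕ) (hk : k ≤ N) (hka : k ≠ a + 1) :
    cN (pmv true a x) k % 3 =
      (cN x k + (if a + 2 ≤ k then 1 else 2) * sgN (zpar x (a + 1))) % 3 := by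
  rw [pmv_eq_orbL, cN_orbL x k hk _ (fun p hp => by
    simp only [List.mem_cons, List.not_mem_nil, or_false] at hp
    rcases hp with rfl | rfl <;> dsimp only <;> omega) (by simp)]
  have hz : zpar x (a + 1 + 1) = zpar x (a + 1) := by
    rw [zpar_succ x (show a + 1 < N by omega), hx]; simp
  simp only [List.map_cons, List.map_nil, List.sum_cons, List.sum_nil]
  rw [hz]
  cases zpar x (a + 1) <;> by_cases h1 : a + 1 ≤ k <;> by_cases h2 : a + 1 + 1 ≤ k <;> by_cases h3 : a + 2 ≤ k <;>
    simp [sh, sgN, h1, h2] <;> omega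

/-- BlindDialA helper `cN_pmv_false` (decomp-qadv g20 land package; see the module docstring). -/
theorem cN_pmv_false (a : ℕ) (x : Fin N → Bool) (k : ℕ) : cN (pmv false a x) k = cN x k := rfl

/-! ## §2 The rotations: four optional pair moves at the unread first-half cells `0, 4, 10, 14` -/

/-- sign quadruple of flags. -/
abbrev B4 := Bool × Bool × Bool × Bool

/-- the 16 ROTATIONS of an input. -/
def rot (ε : B4) (x : Fin N → Bool) : Fin N → Bool :=
  pmv ε.1 0 (pmv ε.2.1 4 (pmv ε.2.2.1 10 (pmv ε.2.2.2 14 x)))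

/-- the rotation as a list of optional adjacent pair-flips. -/
def rotL (ε : B4) : List (Bool × ℕ) :=
  [(ε.1, 0), (ε.1, 1), (ε.2.1, 4), (ε.2.1, 5), (ε.2.2.1, 10), (ε.2.2.1, 11), (ε.2.2.2, 14), (ε.2.2.2, 15)]

/-- BlindDialA helper `rot_eq_orbL` (decomp-qadv g20 land package; see the module docstring). -/
theorem rot_eq_orbL (ε : B4) (x : Fin N → Bool) : rot ε x = orbL (rotL ε) x := rfl

/-- `j` is not a rotation cell. -/
def NotRot (j : ℕ) : Prop := j ≠ 0 ∧ j ≠ 2 ∧ j ≠ 4 ∧ j ≠ 6 ∧ j ≠ 10 ∧ j ≠ 12 ∧ j ≠ 14 ∧ j ≠ 16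

/-- BlindDialA helper `rot_apply_of_ne` (decomp-qadv g20 land package; see the module docstring). -/
theorem rot_apply_of_ne (ε : B4) (x : Fin N → Bool) (j : Fin N) (hj : NotRot j.val) : rot ε x j = x j := by
  unfold rot; unfold NotRot at hj
  rw [pmv_apply_of_ne _ _ hj.1 hj.2.1, pmv_apply_of_ne _ _ hj.2.2.1 hj.2.2.2.1,
    pmv_apply_of_ne _ _ hj.2.2.2.2.1 hj.2.2.2.2.2.1, pmv_apply_of_ne _ _ hj.2.2.2.2.2.2.1 hj.2.2.2.2.2.2.2]

/-- BlindDialA helper `rot_apply_of_not_moved` (decomp-qadv g20 land package; see the module docstring). -/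
theorem rot_apply_of_not_moved (ε : B4) (x : Fin N → Bool) (j : Fin N) (hj : ¬ Moved N j.val) : rot ε x j = x j :=
  rot_apply_of_ne ε x j (by unfold Moved at hj; unfold NotRot; omega)

/-- BlindDialA helper `oddZeros_rot` (decomp-qadv g20 land package; see the module docstring). -/
theorem oddZeros_rot (hN : 18 ≤ N) (ε : B4) (x : Fin N → Bool) : OddZeros (rot ε x) ↔ OddZeros x := by
  unfold rot
  rw [oddZeros_pmv _ (by omega), oddZeros_pmv _ (by omega), oddZeros_pmv _ (by omega), oddZeros_pmv _ (by omega)]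

/-- BlindDialA helper `zpar_rot` (decomp-qadv g20 land package; see the module docstring). -/
theorem zpar_rot (hN : 18 ≤ N) (ε : B4) (x : Fin N → Bool) (k : ℕ) (hk : k ≤ N)
    (h : k ≠ 1 ∧ k ≠ 2 ∧ k ≠ 5 ∧ k ≠ 6 ∧ k ≠ 11 ∧ k ≠ 12 ∧ k ≠ 15 ∧ k ≠ 16) : zpar (rot ε x) k = zpar x k := by
  unfold rot
  rw [zpar_pmv_of_ne _ (by omega) _ k hk (by omega) (by omega), zpar_pmv_of_ne _ (by omega) _ k hk (by omega) (by omega),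
    zpar_pmv_of_ne _ (by omega) _ k hk (by omega) (by omega), zpar_pmv_of_ne _ (by omega) _ k hk (by omega) (by omega)]

/-- an optional pair move's phase shift past / before the pair, middle cell `1`. -/
theorem cN_pmv_opt {a : ℕ} (ha : a + 4 ≤ N) (t : Bool) (x : Fin N → Bool) (hx : x ⟨a + 1, by omega⟩ = true)
    (k : ℕ) (hk : k ≤ N) (hka : k ≠ a + 1) :
    cN (pmv t a x) k % 3 =
      (cN x k + if t = true then (if a + 2 ≤ k then 1 else 2) * sgN (zpar x (a + 1)) else 0) % 3 := by
  cases t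
  · simp [cN_pmv_false]
  · rw [cN_pmv_mid_true ha x hx k hk hka]; simp

/-- the common shift `T` (pairs at `0`, `4`: every position `≥ 6` moves by `T`) and the relative shift `M` (pairs at
`10`, `14`: positions `≤ 9` move by `2M`, positions `≥ 17` by `M`). -/
def Tof (t₁ t₂ z z' : Bool) : ℕ := (if t₁ = true then sgN z else 0) + (if t₂ = true then sgN z' else 0)

/-- `T`: the signed count of active pairs among `0, 4`. -/
def TT (ε : B4) (x : Fin N → Bool) : ℕ := Tof ε.1 ε.2.1 (zpar x 1) (zpar x 5)

/-- `M`: the signed count of active pairs among `10, 14`. -/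
def MM (ε : B4) (x : Fin N → Bool) : ℕ := Tof ε.2.2.1 ε.2.2.2 (zpar x 11) (zpar x 15)

/-- the four sign cells `1, 5, 11, 15` hold `1` (so each pair move is a rotation with a definite sign). -/
def SignFix (x : Fin N → Bool) : Prop := ∀ j : Fin N, (j.val = 1 ∨ j.val = 5 ∨ j.val = 11 ∨ j.val = 15) → x j = true

/-- BlindDialA helper `cN_rot_low` (decomp-qadv g20 land package; see the module docstring). -/
theorem cN_rot_low (hN : 18 ≤ N) (ε : B4) (x : Fin N → Bool) (hs : SignFix x) (k : ℕ) (hk : 6 ≤ k ∧ k ≤ 9) :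
    cN (rot ε x) k % 3 = (cN x k + TT ε x + 2 * MM ε x) % 3 := by
  obtain ⟨t₁, t₂, m₁, m₂⟩ := ε
  have hkN : k ≤ N := by omega
  set y₃ := pmv m₂ 14 x with hy₃
  set y₂ := pmv m₁ 10 y₃ with hy₂
  set y₁ := pmv t₂ 4 y₂ with hy₁
  have e0 : rot (t₁, t₂, m₁, m₂) x = pmv t₁ 0 y₁ := rfl
  have s3 := cN_pmv_opt (a := 14) (by omega) m₂ x (hs ⟨15, by omega⟩ (by simp)) k hkN (by omega)
  have hy₃_11 : y₃ ⟨11, by omega⟩ = true := by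
    rw [hy₃, pmv_apply_of_ne _ _ (by simp) (by simp)]; exact hs ⟨11, by omega⟩ (by simp)
  have s2 := cN_pmv_opt (a := 10) (by omega) m₁ y₃ hy₃_11 k hkN (by omega)
  have hy₂_5 : y₂ ⟨5, by omega⟩ = true := by
    rw [hy₂, pmv_apply_of_ne _ _ (by simp) (by simp), hy₃, pmv_apply_of_ne _ _ (by simp) (by simp)]
    exact hs ⟨5, by omega⟩ (by simp)
  have s1 := cN_pmv_opt (a := 4) (by omega) t₂ y₂ hy₂_5 k hkN (by omega)
  have hy₁_1 : y₁ ⟨1, by omega⟩ = true := by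
    rw [hy₁, pmv_apply_of_ne _ _ (by simp) (by simp), hy₂, pmv_apply_of_ne _ _ (by simp) (by simp), hy₃,
      pmv_apply_of_ne _ _ (by simp) (by simp)]
    exact hs ⟨1, by omega⟩ (by simp)
  have s0 := cN_pmv_opt (a := 0) (by omega) t₁ y₁ hy₁_1 k hkN (by omega)
  have z11 : zpar y₃ 11 = zpar x 11 := by rw [hy₃, zpar_pmv_of_ne _ (by omega) _ 11 (by omega) (by omega) (by omega)]
  have z5 : zpar y₂ 5 = zpar x 5 := by
    rw [hy₂, zpar_pmv_of_ne _ (by omega) _ 5 (by omega) (by omega) (by omega), hy₃,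
      zpar_pmv_of_ne _ (by omega) _ 5 (by omega) (by omega) (by omega)]
  have z1 : zpar y₁ 1 = zpar x 1 := by
    rw [hy₁, zpar_pmv_of_ne _ (by omega) _ 1 (by omega) (by omega) (by omega), hy₂,
      zpar_pmv_of_ne _ (by omega) _ 1 (by omega) (by omega) (by omega), hy₃,
      zpar_pmv_of_ne _ (by omega) _ 1 (by omega) (by omega) (by omega)]
  rw [e0, s0, z1]
  rw [z11, ← hy₂] at s2
  rw [z5, ← hy₁] at s1
  rw [← hy₃] at s3
  unfold TT MM Tof
  simp only
  have h02 : 0 + 2 ≤ k := by omega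
  have h42 : 4 + 2 ≤ k := by omega
  have h102 : ¬ 10 + 2 ≤ k := by omega
  have h142 : ¬ 14 + 2 ≤ k := by omega
  simp only [h02, h42, h102, h142, if_true] at s0 s1 s2 s3 ⊢
  cases t₁ <;> cases t₂ <;> cases m₁ <;> cases m₂ <;> simp at s0 s1 s2 s3 ⊢ <;> omega

/-- BlindDialA helper `cN_rot_high` (decomp-qadv g20 land package; see the module docstring). -/
theorem cN_rot_high (hN : 18 ≤ N) (ε : B4) (x : Fin N → Bool) (hs : SignFix x) (k : ℕ) (hk : 17 ≤ k ∧ k ≤ N) :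
    cN (rot ε x) k % 3 = (cN x k + TT ε x + MM ε x) % 3 := by
  obtain ⟨t₁, t₂, m₁, m₂⟩ := ε
  have hkN : k ≤ N := hk.2
  set y₃ := pmv m₂ 14 x with hy₃
  set y₂ := pmv m₁ 10 y₃ with hy₂
  set y₁ := pmv t₂ 4 y₂ with hy₁
  have e0 : rot (t₁, t₂, m₁, m₂) x = pmv t₁ 0 y₁ := rfl
  have s3 := cN_pmv_opt (a := 14) (by omega) m₂ x (hs ⟨15, by omega⟩ (by simp)) k hkN (by omega)
  have hy₃_11 : y₃ ⟨11, by omega⟩ = true := by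
    rw [hy₃, pmv_apply_of_ne _ _ (by simp) (by simp)]; exact hs ⟨11, by omega⟩ (by simp)
  have s2 := cN_pmv_opt (a := 10) (by omega) m₁ y₃ hy₃_11 k hkN (by omega)
  have hy₂_5 : y₂ ⟨5, by omega⟩ = true := by
    rw [hy₂, pmv_apply_of_ne _ _ (by simp) (by simp), hy₃, pmv_apply_of_ne _ _ (by simp) (by simp)]
    exact hs ⟨5, by omega⟩ (by simp)
  have s1 := cN_pmv_opt (a := 4) (by omega) t₂ y₂ hy₂_5 k hkN (by omega)
  have hy₁_1 : y₁ ⟨1, by omega⟩ = true := by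
    rw [hy₁, pmv_apply_of_ne _ _ (by simp) (by simp), hy₂, pmv_apply_of_ne _ _ (by simp) (by simp), hy₃,
      pmv_apply_of_ne _ _ (by simp) (by simp)]
    exact hs ⟨1, by omega⟩ (by simp)
  have s0 := cN_pmv_opt (a := 0) (by omega) t₁ y₁ hy₁_1 k hkN (by omega)
  have z11 : zpar y₃ 11 = zpar x 11 := by rw [hy₃, zpar_pmv_of_ne _ (by omega) _ 11 (by omega) (by omega) (by omega)]
  have z5 : zpar y₂ 5 = zpar x 5 := by
    rw [hy₂, zpar_pmv_of_ne _ (by omega) _ 5 (by omega) (by omega) (by omega), hy₃,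
      zpar_pmv_of_ne _ (by omega) _ 5 (by omega) (by omega) (by omega)]
  have z1 : zpar y₁ 1 = zpar x 1 := by
    rw [hy₁, zpar_pmv_of_ne _ (by omega) _ 1 (by omega) (by omega) (by omega), hy₂,
      zpar_pmv_of_ne _ (by omega) _ 1 (by omega) (by omega) (by omega), hy₃,
      zpar_pmv_of_ne _ (by omega) _ 1 (by omega) (by omega) (by omega)]
  rw [e0, s0, z1]
  rw [z11, ← hy₂] at s2
  rw [z5, ← hy₁] at s1
  rw [← hy₃] at s3
  unfold TT MM Tof
  simp only
  have h02 : 0 + 2 ≤ k := by omega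
  have h42 : 4 + 2 ≤ k := by omega
  have h102 : 10 + 2 ≤ k := by omega
  have h142 : 14 + 2 ≤ k := by omega
  simp only [h02, h42, h102, h142, if_true] at s0 s1 s2 s3 ⊢
  cases t₁ <;> cases t₂ <;> cases m₁ <;> cases m₂ <;> simp at s0 s1 s2 s3 ⊢ <;> omega


end Summit.QuantumAdvantage.QuantumAdvantage.Theorems.BlindDial
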